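import Mathlib
import HarnessLib
import Literature.NumberTheory.Automorphic.BaseChangeCyclicCuspidalProofs
import Literature.NumberTheory.Automorphic.AutomorphicRepsGLCuspidalUnitaryHolds
import Literature.NumberTheory.Automorphic.StrongMultiplicityOneRepDataAE
import Literature.NumberTheory.Automorphic.BaseChangeArchimedeanOfExists
import Literature.NumberTheory.Automorphic.AdelicGroupDataAutomorphicMeasureProofs
import Literature.NumberTheory.Automorphic.TunnellOctahedralGlobal
import Literature.NumberTheory.Automorphic.JacquetLanglandsParts

/-!
# Stub `stub_allFinite_descends_of_exists` of line Sketch (crux stmt-Langlands-16812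
`ParityBlindBianchi.QuadraticBaseChangeGL2`) — clauses (c) and (b)(ii) for EVERY cuspidal weak lift

Helper file (`--supports stmt-Langlands-16812`) of the quadratic base change theorem for `GL₂`.
The crux asserts, for `E/F` Galois quadratic and `π` cuspidal on `GL₂(𝔸_F)`, that EVERY cuspidal
weak base-change lift `P` of `π` to `E` (Arthur–Clozel 1989, Ch. 3, Def. 1.1, in the Borel–Jacquet
datum model `IsWeakBaseChangeLiftAE`) satisfies

* (c) the Hecke relation `t_{P,w} = t_{π,v}^{f(w|v)}` at EVERY finite place `w ∣ v` at which `π_v`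
  is unramified, and
* (b)(ii) over the places `v` unramified in `E`: `P` unramified at every `w ∣ v` forces `π_v`
  unramified.

This file derives both from the EXISTENCE form (`hex`: ONE cuspidal weak lift `P₀` with (c), (b)(ii)
and the archimedean clause) and strong multiplicity one at the spherical levels on `GL₂` over `E`
(`hsmo`, `strong_multiplicity_one_gl_sphericalLevel 2 E`; Jacquet–Shalika 1981, Thm. 4.4):

* `stub_allFinite_descends_of_exists` — the registered stub.  Route: `P` and `P₀` are two weak lifts
  of the same `π`, hence nearly equivalent (`IsWeakBaseChangeLiftAE.isNearlyEquivalent`, Flath);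
  nearly equivalent CUSPIDAL data on `GL_n(𝔸_K)`, `n ≥ 1`, have the same Satake parameters at EVERY
  finite place (private `hasSatakeParamAt_iff_of_isNearlyEquivalent_of_smo`: clean models with the
  same Satake parameters place by place,
  `CuspidalAutomorphicRepData.exists_clean_hasSatakeParamAt_iff_of_sSup_irreducible` with the proved
  semisimplicity `AutomorphicRepsGL.stable_cuspidal_eq_sSup_irreducible_holds`; the clean models are
  again nearly equivalent, hence have the same space of forms by
  `CuspidalAutomorphicRepData.W_eq_of_isNearlyEquivalent_of_clean_of_smo` for the automorphic measure
  of `AdelicGroupData.exists_isAutomorphicMeasure_gl_holds`, hence are EQUAL data); so (c) and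
  (b)(ii) transport from `P₀` to `P` verbatim (`IsUnramifiedAt v = ∃ α, HasSatakeParamAt v α`).

No definitions, no named facts.
-/

noncomputable section

open scoped BigOperators Topology Classical Matrix NumberField MatrixGroups
open Literature.NumberTheory.Automorphic IsDedekindDomain NumberField Filter MeasureTheory
open Literature.NumberTheory.Automorphic.AdelicGroupData

-- `Summit.Langlands.Langlands.…`: summit = sub-problem name (D-0017 nested layout), not a typo.
set_option linter.dupNamespace false

namespace Summit.Langlands.Langlands.Theorems.QuadraticBaseChangeGL2

/-! ### Nearly equivalent cuspidal data have the same Satake parameters everywhere -/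

/-- Two Borel–Jacquet data on `GL_n(𝔸_K)` with the same spaces `W` and `W'` are equal (the other
fields of `AutomorphicRepData` are propositions). [folklore] -/
private theorem repData_eq_of_W_eq {n : ℕ} {K : Type} [Field K] [NumberField K]
    {hcpt : isCompact_glFiniteIntegralLevel n K}
    {π π' : AutomorphicRepData (AutomorphyDatum.gl n K hcpt)}
    (hW : π.W = π'.W) (hW' : π.W' = π'.W') : π = π' := by
  cases π
  cases π'
  dsimp only at hW hW'
  subst hW
  subst hW'
  rfl

/-- **Strong multiplicity one for cuspidal Borel–Jacquet data, Satake form at EVERY place, from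
`strong_multiplicity_one_gl_sphericalLevel` alone** (Jacquet–Shalika 1981, Thm. 4.4: nearly
equivalent cuspidal automorphic representations of `GL_n(𝔸_K)` are isomorphic, in particular at
every finite place).  For `n ≥ 1` and cuspidal data `π, π'` on `GL_n(𝔸_K)` which are nearly
equivalent, `π` has Satake parameter `β` at `v` iff `π'` does, for EVERY finite place `v` and every
`β`, granted `strong_multiplicity_one_gl_sphericalLevel n K`.  Proof: that of
`CuspidalAutomorphicRepData.hasArchParameter_eq_of_isNearlyEquivalent_of_smo` — clean models with
the same Satake parameters place by place
(`exists_clean_hasSatakeParamAt_iff_of_sSup_irreducible` with the proved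
`stable_cuspidal_eq_sSup_irreducible_holds`), again nearly equivalent, hence with equal spaces of
forms (`W_eq_of_isNearlyEquivalent_of_clean_of_smo`, for the automorphic measure of
`exists_isAutomorphicMeasure_gl_holds`), i.e. equal data, whose Satake parameters are those of `π`
and of `π'`. [cite: JacquetShalikaAJM1981II, Thm. 4.4] -/
private theorem hasSatakeParamAt_iff_of_isNearlyEquivalent_of_smo {n : ℕ} [NeZero n] {K : Type}
    [Field K] [NumberField K] {hcpt : isCompact_glFiniteIntegralLevel n K}
    (hsmo : strong_multiplicity_one_gl_sphericalLevel n K)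
    (π π' : CuspidalAutomorphicRepData n K hcpt) (hne : π.1.IsNearlyEquivalent π'.1)
    (v : HeightOneSpectrum (𝓞 K)) (β : Multiset ℂ) :
    π.1.HasSatakeParamAt v β ↔ π'.1.HasSatakeParamAt v β := by
  obtain ⟨π₀, h0, h0sat⟩ :=
    CuspidalAutomorphicRepData.exists_clean_hasSatakeParamAt_iff_of_sSup_irreducible
      AutomorphicRepsGL.stable_cuspidal_eq_sSup_irreducible_holds π
  obtain ⟨π₀', h0', h0sat'⟩ :=
    CuspidalAutomorphicRepData.exists_clean_hasSatakeParamAt_iff_of_sSup_irreducible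
      AutomorphicRepsGL.stable_cuspidal_eq_sSup_irreducible_holds π'
  -- the clean models are nearly equivalent
  have hne0 : π₀.1.IsNearlyEquivalent π₀'.1 := by
    have hne' : ∀ᶠ u : HeightOneSpectrum (𝓞 K) in cofinite,
        ∃ α : Multiset ℂ, π.1.HasSatakeParamAt u α ∧ π'.1.HasSatakeParamAt u α := hne
    change ∀ᶠ u : HeightOneSpectrum (𝓞 K) in cofinite,
        ∃ α : Multiset ℂ, π₀.1.HasSatakeParamAt u α ∧ π₀'.1.HasSatakeParamAt u α
    filter_upwards [hne'] with u ⟨α, hα, hα'⟩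
    exact ⟨α, (h0sat u α).2 hα, (h0sat' u α).2 hα'⟩
  -- strong multiplicity one on the clean models: `π₀ = π₀'`
  obtain ⟨μm, hμm⟩ := AdelicGroupData.exists_isAutomorphicMeasure_gl_holds n K
  haveI := hμm
  have hW : π₀.1.W = π₀'.1.W :=
    CuspidalAutomorphicRepData.W_eq_of_isNearlyEquivalent_of_clean_of_smo (μm := μm) hsmo π₀ π₀'
      h0 h0' hne0
  have heq : π₀ = π₀' := Subtype.ext (repData_eq_of_W_eq hW (h0.trans h0'.symm))
  subst heq
  exact (h0sat v β).symm.trans (h0sat' v β)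

/-! ### The stub -/

/-- **Stub `stub_allFinite_descends_of_exists`** — clauses (c) and (b)(ii) of quadratic base change
for `GL₂` for EVERY cuspidal weak lift `P` of `π`, from the existence form and strong multiplicity
one at the spherical levels on `GL₂` over `E` (`strong_multiplicity_one_gl_sphericalLevel`,
Jacquet–Shalika 1981, Thm. 4.4).  Route: the existence form gives a good cuspidal weak lift `P₀`
with (i) the relation `t_{P₀,w} = t_{π,v}^{f(w|v)}` at every finite `w ∣ v` with `π_v` unramified
and (ii) descent of unramifiedness over the places unramified in `E`; `P` and `P₀` are nearly
equivalent (`IsWeakBaseChangeLiftAE.isNearlyEquivalent`, Flath for `π`); nearly equivalent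
cuspidal data have the same Satake parameters and the same unramified places EVERYWHERE
(`hasSatakeParamAt_iff_of_isNearlyEquivalent_of_smo`: clean models,
`CuspidalAutomorphicRepData.W_eq_of_isNearlyEquivalent_of_clean_of_smo`); transport (i), (ii) from
`P₀` to `P`. [cite: JacquetShalikaAJM1981II, Thm. 4.4] -/
theorem stub_allFinite_descends_of_exists
    (hex : ∀ (F E : Type) [Field F] [NumberField F] [Field E] [NumberField E] [Algebra F E] [IsGalois F E], Module.finrank F E = 2 → ∀ (hF : Literature.NumberTheory.Automorphic.isCompact_glFiniteIntegralLevel 2 F) (hE : Literature.NumberTheory.Automorphic.isCompact_glFiniteIntegralLevel 2 E) (π : Literature.NumberTheory.Automorphic.CuspidalAutomorphicRepData 2 F hF), (∃ P : Literature.NumberTheory.Automorphic.CuspidalAutomorphicRepData 2 E hE, Literature.NumberTheory.Automorphic.IsWeakBaseChangeLiftAE π.1 P.1) → ∃ P₀ : Literature.NumberTheory.Automorphic.CuspidalAutomorphicRepData 2 E hE, (∀ (w : IsDedekindDomain.HeightOneSpectrum (NumberField.RingOfIntegers E)) (v : IsDedekindDomain.HeightOneSpectrum (NumberField.RingOfIntegers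 F)) (α : Multiset ℂ), w.asIdeal.under (NumberField.RingOfIntegers F) = v.asIdeal → π.1.HasSatakeParamAt v α → P₀.1.HasSatakeParamAt w (α.map (· ^ w.asIdeal.inertiaDeg (NumberField.RingOfIntegers F)))) ∧ (∀ v : IsDedekindDomain.HeightOneSpectrum (NumberField.RingOfIntegers F), Algebra.IsUnramifiedIn (NumberField.RingOfIntegers E) v.asIdeal → (∀ w : IsDedekindDomain.HeightOneSpectrum (NumberField.RingOfIntegers E), w.asIdeal.under (NumberField.RingOfIntegers F) = v.asIdeal → P₀.1.IsUnramifiedAt w) → π.1.IsUnramifiedAt v) ∧ (∀ χ : (F →+* ℂ) → Multiset ℂ, π.1.HasArchParameter χ → P₀.1.HasArchParameter fun τ => χ (τ.comp (algebraMap F E))))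
    (hsmo : ∀ (K : Type) [Field K] [NumberField K], strong_multiplicity_one_gl_sphericalLevel 2 K) :
    (∀ (F E : Type) [Field F] [NumberField F] [Field E] [NumberField E] [Algebra F E] [IsGalois F E], Module.finrank F E = 2 → ∀ (hF : Literature.NumberTheory.Automorphic.isCompact_glFiniteIntegralLevel 2 F) (hE : Literature.NumberTheory.Automorphic.isCompact_glFiniteIntegralLevel 2 E) (π : Literature.NumberTheory.Automorphic.CuspidalAutomorphicRepData 2 F hF) (P : Literature.NumberTheory.Automorphic.CuspidalAutomorphicRepData 2 E hE), Literature.NumberTheory.Automorphic.IsWeakBaseChangeLiftAE π.1 P.1 → ∀ (w : IsDedekindDomain.HeightOneSpectrum (NumberField.RingOfIntegers E)) (v : IsDedekindDomain.HeightOneSpectrum (NumberField.RingOfIntegers F)) (α : Multiset ℂ), w.asIdeal.under (NumberField.RingOfIntegers F) = v.asIdeal → π.1.HasSatakeParamAt v α → P.1.HasSatakeParamAt w (α.map (· ^ w.asIdeal.inertiaDeg (NumberField.RingOfIntegers F)))) ∧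
    (∀ (F E : Type) [Field F] [NumberField F] [Field E] [NumberField E] [Algebra F E] [IsGalois F E], Module.finrank F E = 2 → ∀ (hF : Literature.NumberTheory.Automorphic.isCompact_glFiniteIntegralLevel 2 F) (hE : Literature.NumberTheory.Automorphic.isCompact_glFiniteIntegralLevel 2 E) (π : Literature.NumberTheory.Automorphic.CuspidalAutomorphicRepData 2 F hF) (P : Literature.NumberTheory.Automorphic.CuspidalAutomorphicRepData 2 E hE), Literature.NumberTheory.Automorphic.IsWeakBaseChangeLiftAE π.1 P.1 → ∀ v : IsDedekindDomain.HeightOneSpectrum (NumberField.RingOfIntegers F), Algebra.IsUnramifiedIn (NumberField.RingOfIntegers E) v.asIdeal → (∀ w : IsDedekindDomain.HeightOneSpectrum (NumberField.RingOfIntegers E), w.asIdeal.under (NumberField.RingOfIntegers F) = v.asIdeal → P.1.IsUnramifiedAt w) → π.1.IsUnramifiedAt v) := by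
  -- shared transport: a good lift `P₀` with (i), (ii), and `P`, `P₀` have the same Satake parameters
  -- at EVERY finite place of `E`
  have key : ∀ (F E : Type) [Field F] [NumberField F] [Field E] [NumberField E] [Algebra F E]
      [IsGalois F E], Module.finrank F E = 2 →
      ∀ (hF : isCompact_glFiniteIntegralLevel 2 F) (hE : isCompact_glFiniteIntegralLevel 2 E)
        (π : CuspidalAutomorphicRepData 2 F hF) (P : CuspidalAutomorphicRepData 2 E hE),
        IsWeakBaseChangeLiftAE π.1 P.1 →
          ∃ P₀ : CuspidalAutomorphicRepData 2 E hE,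
            (∀ (w : HeightOneSpectrum (𝓞 E)) (v : HeightOneSpectrum (𝓞 F)) (α : Multiset ℂ),
              w.asIdeal.under (𝓞 F) = v.asIdeal → π.1.HasSatakeParamAt v α →
                P₀.1.HasSatakeParamAt w (α.map (· ^ w.asIdeal.inertiaDeg (𝓞 F)))) ∧
            (∀ v : HeightOneSpectrum (𝓞 F), Algebra.IsUnramifiedIn (𝓞 E) v.asIdeal →
              (∀ w : HeightOneSpectrum (𝓞 E), w.asIdeal.under (𝓞 F) = v.asIdeal →
                P₀.1.IsUnramifiedAt w) → π.1.IsUnramifiedAt v) ∧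
            ∀ (w : HeightOneSpectrum (𝓞 E)) (β : Multiset ℂ),
              P.1.HasSatakeParamAt w β ↔ P₀.1.HasSatakeParamAt w β := by
    intro F E _ _ _ _ _ _ h2 hF hE π P hBC
    obtain ⟨P₀, hi, hii, -⟩ := hex F E h2 hF hE π ⟨P, hBC⟩
    -- `P₀` is a weak lift (the relation holds at every place, a fortiori at almost every place)
    have hBC₀ : IsWeakBaseChangeLiftAE π.1 P₀.1 :=
      Filter.Eventually.of_forall fun w v α h hα => hi w v α h hα
    -- two weak lifts of one `π` are nearly equivalent
    have hne : P.1.IsNearlyEquivalent P₀.1 := hBC.isNearlyEquivalent hBC₀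
    exact ⟨P₀, hi, hii, fun w β =>
      hasSatakeParamAt_iff_of_isNearlyEquivalent_of_smo (hsmo E) P P₀ hne w β⟩
  refine ⟨?_, ?_⟩
  · -- clause (c): the relation at every finite place, transported from `P₀` to `P`
    intro F E _ _ _ _ _ _ h2 hF hE π P hBC w v α hwv hα
    obtain ⟨P₀, hi, -, hiff⟩ := key F E h2 hF hE π P hBC
    exact (hiff w _).2 (hi w v α hwv hα)
  · -- clause (b)(ii): `P` unramified at all `w ∣ v` ⟹ `P₀` unramified at all `w ∣ v` ⟹ `π_v` unramified
    intro F E _ _ _ _ _ _ h2 hF hE π P hBC v hv hP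
    obtain ⟨P₀, -, hii, hiff⟩ := key F E h2 hF hE π P hBC
    refine hii v hv fun w hw => ?_
    obtain ⟨β, hβ⟩ := hP w hw
    exact ⟨β, (hiff w β).1 hβ⟩

end Summit.Langlands.Langlands.Theorems.QuadraticBaseChangeGL2

end
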